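import Summits.KontsevichZagierPeriods.KontsevichZagierPeriods.Theses.HyperbolicBloch
import Literature.NumberTheory.Transcendental.KZSemiCanonicalReductionProofs
import Literature.NumberTheory.Transcendental.KZLogCalculusProofs

/-!
# Candidate proof of `stub_valuationKernel` (line `valuation-kernel-sweep`, crux stmt-KontsevichZagierPeriods-3469)

drefute seat refuter-drefute-stmt-KontsevichZagierPeriods-3469-g2-0. The registered stub, VERBATIM, proved from the
tree's bookkeeping lemmas `KZ.of_sub_sum_of_mem_relations` (iterated exact domain additivity),
`KZ.of_mem_relations_of_volume_eq_zero` (null domains are relations) and `KZ.of_sub_of_mem_relations_of_eqOn`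
(congruence of representations with equal domain and integrands agreeing there).

Proof: refine every `r i` to the Boolean atoms `A S = ⋂_{i∈S} σᵢ ∩ ⋂_{i∉S} σᵢᶜ` (`S ⊆ Fin k`); swap the sums; on a
null atom every piece is a relation; on a non-null atom the a.e. hypothesis evaluated at one of its points gives
`∑_{i∈S} cᵢ = 0`, the pieces with `i ∉ S` have empty domain, and those with `i ∈ S` are pairwise congruent.
-/

noncomputable section

open MeasureTheory Set

namespace Summit.KontsevichZagierPeriods.HyperbolicBloch.FiveTerm.Drefute

open Literature.NumberTheory.Transcendental
open Literature.NumberTheory.Transcendental.KZ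
open Literature.ModelTheory.ExponentialFields (IsSemialgebraic)

/-- **Kernel (valuation) lemma** — the registered stub `stub_valuationKernel` verbatim. [folklore] -/
theorem stub_valuationKernel_proof :
    ∀ (n k : ℕ) (r : Fin k → KZ.IntegralRep n) (c : Fin k → ℤ) (g : (Fin n → ℝ) → ℝ),
      (∀ i, Set.EqOn (r i).integrand g (r i).domain) →
      (∀ᵐ (p : Fin n → ℝ), ∑ i, (c i : ℝ) * (r i).domain.indicator (fun _ => (1 : ℝ)) p = 0) →
      ∑ i, c i • KZ.of (r i) ∈ KZ.relations := by
  intro n k r c g hg hae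
  classical
  -- Boolean atoms of the domains
  let A : Finset (Fin k) → Set (Fin n → ℝ) := fun S =>
    (⋂ i ∈ S, (r i).domain) ∩ ⋂ i ∈ Sᶜ, ((r i).domain)ᶜ
  have hAsa : ∀ S, IsSemialgebraic ℚ (A S) := fun S =>
    (IsSemialgebraic.biInter S (fun i => (r i).domain) fun i _ => (r i).isSemialgebraic_domain).inter
      (IsSemialgebraic.biInter Sᶜ (fun i => ((r i).domain)ᶜ)
        fun i _ => (r i).isSemialgebraic_domain.compl)
  have memA : ∀ S p, p ∈ A S ↔ ∀ i, p ∈ (r i).domain ↔ i ∈ S := by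
    intro S p
    simp only [A, Set.mem_inter_iff, Set.mem_iInter, Set.mem_compl_iff, Finset.mem_compl]
    constructor
    · rintro ⟨h1, h2⟩ i
      exact ⟨fun hp => by_contra fun hi => h2 i hi hp, fun hi => h1 i hi⟩
    · intro h
      exact ⟨fun i hi => (h i).2 hi, fun i hi hp => hi ((h i).1 hp)⟩
  -- the pieces: `r i` restricted to `σ i ∩ A S`
  let R : Fin k → Finset (Fin k) → KZ.IntegralRep n := fun i S =>
    (r i).restrict ((r i).domain ∩ A S) ((r i).isSemialgebraic_domain.inter (hAsa S))
      Set.inter_subset_left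
  have hRdom : ∀ i S, (R i S).domain = (r i).domain ∩ A S := fun i S => rfl
  -- Step A: each `r i` is the exact disjoint union of its pieces
  have stepA : ∀ i, KZ.of (r i) - ∑ S, KZ.of (R i S) ∈ KZ.relations := by
    intro i
    refine KZ.of_sub_sum_of_mem_relations Finset.univ (r i) (R i) ?_ ?_ ?_ ?_
    · intro S _
      rw [hRdom, Set.sdiff_eq_empty.mpr Set.inter_subset_left, measure_empty]
    · intro S _ x _
      rfl
    · have h0 : (r i).domain \ ⋃ S ∈ (Finset.univ : Finset (Finset (Fin k))), (R i S).domain = ∅ := by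
        apply Set.sdiff_eq_empty.mpr
        intro p hp
        simp only [Finset.mem_univ, Set.iUnion_true, Set.mem_iUnion, hRdom]
        refine ⟨Finset.univ.filter fun j => p ∈ (r j).domain, hp, ?_⟩
        rw [memA]
        intro j
        simp
      rw [h0, measure_empty]
    · intro S _ S' _ hSS'
      have h0 : (R i S).domain ∩ (R i S').domain = ∅ := by
        apply Set.eq_empty_of_forall_notMem
        rintro p ⟨⟨-, hpS⟩, ⟨-, hpS'⟩⟩
        apply hSS'
        ext j
        rw [memA] at hpS hpS'
        rw [← hpS j, ← hpS' j]
      rw [h0, measure_empty]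
  -- Step D: on a non-null atom the coefficients of the domains containing it sum to zero
  have stepD : ∀ S, volume (A S) ≠ 0 → ∑ i ∈ S, c i = 0 := by
    intro S hS
    by_contra hc
    apply hS
    rw [ae_iff] at hae
    refine measure_mono_null ?_ hae
    intro p hp
    simp only [Set.mem_setOf_eq]
    rw [memA] at hp
    have hsum : ∑ i, (c i : ℝ) * ((r i).domain).indicator (fun _ => (1 : ℝ)) p = ∑ i ∈ S, (c i : ℝ) := by
      rw [← Finset.sum_filter_add_sum_filter_not Finset.univ (fun i => i ∈ S)]
      have h1 : Finset.univ.filter (fun i => i ∈ S) = S := by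
        ext
        simp
      have h2 : ∀ i ∈ Finset.univ.filter (fun i => ¬ i ∈ S),
          (c i : ℝ) * ((r i).domain).indicator (fun _ => (1 : ℝ)) p = 0 := by
        intro i hi
        simp only [Finset.mem_filter, Finset.mem_univ, true_and] at hi
        rw [Set.indicator_of_notMem (fun h => hi ((hp i).1 h)), mul_zero]
      rw [Finset.sum_eq_zero h2, add_zero, h1]
      refine Finset.sum_congr rfl fun i hi => ?_
      rw [Set.indicator_of_mem ((hp i).2 hi), mul_one]
    rw [hsum]
    exact_mod_cast hc
  -- Step C: the combination of the pieces over one atom is a relation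
  have stepC : ∀ S, ∑ i, c i • KZ.of (R i S) ∈ KZ.relations := by
    intro S
    by_cases hS : volume (A S) = 0
    · refine sum_mem fun i _ => AddSubgroup.zsmul_mem _ ?_ _
      exact KZ.of_mem_relations_of_volume_eq_zero _ (measure_mono_null Set.inter_subset_right hS)
    · have hnot : ∀ i, i ∉ S → KZ.of (R i S) ∈ KZ.relations := by
        intro i hi
        apply KZ.of_mem_relations_of_volume_eq_zero
        have h0 : (R i S).domain = ∅ := by
          apply Set.eq_empty_of_forall_notMem
          rintro p ⟨hp, hpA⟩
          exact hi (((memA S p).1 hpA i).1 hp)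
        rw [h0, measure_empty]
      by_cases hSe : S = ∅
      · refine sum_mem fun i _ => AddSubgroup.zsmul_mem _ (hnot i ?_) _
        simp [hSe]
      obtain ⟨i₀, hi₀⟩ := Finset.nonempty_iff_ne_empty.mpr hSe
      have hdomS : ∀ i ∈ S, (R i S).domain = A S := by
        intro i hi
        rw [hRdom]
        apply Set.inter_eq_right.mpr
        intro p hp
        exact ((memA S p).1 hp i).2 hi
      have hcong : ∀ i ∈ S, KZ.of (R i S) - KZ.of (R i₀ S) ∈ KZ.relations := by
        intro i hi
        apply KZ.of_sub_of_mem_relations_of_eqOn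
        · rw [hdomS i hi, hdomS i₀ hi₀]
        · intro p hp
          rw [hdomS i hi] at hp
          have hpi : p ∈ (r i).domain := ((memA S p).1 hp i).2 hi
          have hpi₀ : p ∈ (r i₀).domain := ((memA S p).1 hp i₀).2 hi₀
          show (r i).integrand p = (r i₀).integrand p
          rw [hg i hpi, hg i₀ hpi₀]
      have hsplit : ∑ i, c i • KZ.of (R i S) =
          ∑ i ∈ S, c i • (KZ.of (R i S) - KZ.of (R i₀ S)) + (∑ i ∈ S, c i) • KZ.of (R i₀ S)
            + ∑ i ∈ Finset.univ.filter (fun i => i ∉ S), c i • KZ.of (R i S) := by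
        rw [← Finset.sum_filter_add_sum_filter_not Finset.univ (fun i => i ∈ S)]
        have h1 : Finset.univ.filter (fun i => i ∈ S) = S := by
          ext
          simp
        rw [h1, Finset.sum_smul, ← Finset.sum_add_distrib]
        congr 1
        refine Finset.sum_congr rfl fun i _ => ?_
        rw [smul_sub, sub_add_cancel]
      rw [hsplit, stepD S hS, zero_smul, add_zero]
      refine add_mem (sum_mem fun i hi => AddSubgroup.zsmul_mem _ (hcong i hi) _)
        (sum_mem fun i hi => AddSubgroup.zsmul_mem _ (hnot i ?_) _)
      simpa using hi
  -- Step B: assemble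
  have hB : ∑ i, c i • KZ.of (r i) - ∑ i, c i • ∑ S, KZ.of (R i S) ∈ KZ.relations := by
    rw [← Finset.sum_sub_distrib]
    refine sum_mem fun i _ => ?_
    rw [← smul_sub]
    exact AddSubgroup.zsmul_mem _ (stepA i) _
  have hC : ∑ i, c i • ∑ S, KZ.of (R i S) ∈ KZ.relations := by
    simp_rw [Finset.smul_sum]
    rw [Finset.sum_comm]
    exact sum_mem fun S _ => stepC S
  have h := add_mem hB hC
  rwa [sub_add_cancel] at h

end Summit.KontsevichZagierPeriods.HyperbolicBloch.FiveTerm.Drefute
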